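import Literature.NumberTheory.LFunctions.SelbergSigmaXT
import Literature.NumberTheory.LFunctions.ZeroCountingDerivZetaProofs
import HarnessLib

/-!
# Moments of `σ_{x,t} − ½` from Selberg's zero-density theorem

Topic `Literature/NumberTheory/LFunctions`. Everything in this file is PROVED (no definitions, no
named facts). The zero-density theorem near the critical line enters as an explicit HYPOTHESIS
`hD` of the theorems (Titchmarsh's Theorem 9.19 (C) = Selberg 1946, Thm. 1, with an unspecified
exponent `c > 0`):

  `hD : ∃ c > 0, ∃ C T₀, ∀ T ≥ T₀, ∀ σ ∈ [½, 1], N(σ, T) ≤ C T^{1−c(σ−½)} log T`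
  (`N(σ,T) = zetaZeroCountRe σ T`).

Selberg (*Contributions to the theory of the Riemann zeta-function* (1946), §5) bounds the moments
of `σ_{x,t} − ½` (`x = T^θ`, `3θ < c`) by summing, over the zeros `ρ = β + iγ`, the length
`2x^{3|β−½|}/log x` of the window in which `ρ` can raise `σ_{x,t}`, against the density theorem:

* `Literature.NumberTheory.LFunctions.SelbergMoments.card_filter_dev_ge_le` —
  `#{ρ : 0 < γ ≤ T', |β − ½| ≥ v} ≤ 2 N(½ + v, T')` (reflection `ρ ↦ 1 − ρ̄`);
* `Literature.NumberTheory.LFunctions.SelbergMoments.sum_dev_pow_mul_exp_le` — the key sum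
  `Σ_{0<γ≤2T} |β−½|^m x^{3|β−½|} ≤ K T (log T)^{1−m}` from `hD` (classes `|β−½| ∈ [k/L,(k+1)/L)`,
  `L = log T`);
* `Literature.NumberTheory.LFunctions.SelbergMoments.integral_delta_pow_le` — **the moment bound**
  `∫_{T/2}^{T} (σ_{x,t} − ½)^m dt ≤ C_m T/ℓ^m`, `ℓ = θ log T = log x`.

## References

* A. Selberg, Arch. Math. Naturvid. 48 (1946) no. 5, Thm. 1 and §5. [cite: Titchmarsh1986, Thm. 9.19 (C)]
* E. C. Titchmarsh, *The Theory of the Riemann Zeta-Function*, 2nd ed. (1986), Thm. 9.19 (C)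
  (p. 352 of the held copy: stated without proof), §14.21.
* D. A. Goldston, *Notes on pair correlation of zeros and prime numbers* (2005), §10 (end).
  [cite: Goldston2005, (10.17)–(10.18)]
-/

noncomputable section

open Complex Real MeasureTheory Set Filter Topology
open scoped ComplexConjugate

namespace Literature.NumberTheory.LFunctions

namespace SelbergMoments

/-! ## Counting zeros far from the critical line, both sides -/

/-- A finite set of zeros inside a box has cardinality at most the multiplicity count `N(σ, T')`.
[folklore] -/
theorem card_le_zetaZeroCountRe {σ T' : ℝ} {S : Finset ℂ} (hS : ∀ ρ ∈ S, ρ ∈ zetaZeroBox σ T') :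
    (S.card : ℝ) ≤ (zetaZeroCountRe σ T' : ℝ) := by
  classical
  have hB := zetaZeroBox_finite σ T'
  have hsub : S ⊆ hB.toFinset := fun ρ hρ ↦ (Set.Finite.mem_toFinset hB).2 (hS ρ hρ)
  have hsum : (S.card : ℤ) ≤ ∑ ρ ∈ hB.toFinset, riemannZetaZeroOrder ρ := by
    rw [Finset.card_eq_sum_ones, Nat.cast_sum]
    refine (Finset.sum_le_sum fun ρ hρ ↦ ?_).trans
      (Finset.sum_le_sum_of_subset_of_nonneg hsub fun ρ hρ _ ↦
        riemannZetaZeroOrder_nonneg_of_mem_zetaZeroBox ((Set.Finite.mem_toFinset hB).1 hρ))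
    have hmem := hS ρ hρ
    have hnt : ρ ∈ ZetaZeros.riemannZetaNontrivialZeros :=
      ZetaZeros.riemannZetaNontrivialZeros.mem_of_im_ne_zero hmem.1 hmem.2.2.2.1.ne'
    simpa using ZetaZeros.riemannZetaNontrivialZeros.one_le_order hnt
  have hfin : (∑ᶠ ρ ∈ zetaZeroBox σ T', riemannZetaZeroOrder ρ) = ∑ ρ ∈ hB.toFinset, riemannZetaZeroOrder ρ :=
    finsum_mem_eq_finite_toFinset_sum _ hB
  have hnn : 0 ≤ ∑ ρ ∈ hB.toFinset, riemannZetaZeroOrder ρ :=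
    Finset.sum_nonneg fun ρ hρ ↦ riemannZetaZeroOrder_nonneg_of_mem_zetaZeroBox ((Set.Finite.mem_toFinset hB).1 hρ)
  have hN : (zetaZeroCountRe σ T' : ℤ) = ∑ ρ ∈ hB.toFinset, riemannZetaZeroOrder ρ := by
    rw [zetaZeroCountRe, hfin, Int.toNat_of_nonneg hnn]
  have : (S.card : ℤ) ≤ (zetaZeroCountRe σ T' : ℤ) := by rw [hN]; exact hsum
  exact_mod_cast this

/-- **Zeros at distance `≥ v` from the critical line, both sides**: among the zeros with
`0 < γ ≤ T'` (each counted once), those with `|β − ½| ≥ v` number at most `2 N(½ + v, T')`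
(the zeros to the left are reflected by `ρ ↦ 1 − ρ̄`). [folklore] -/
theorem card_filter_dev_ge_le (T' v : ℝ) :
    ((((zetaZeroBox_finite 0 T').toFinset.filter fun ρ ↦ v ≤ SelbergSigma.dev ρ)).card : ℝ) ≤
      2 * (zetaZeroCountRe (1 / 2 + v) T' : ℝ) := by
  classical
  set F := (zetaZeroBox_finite 0 T').toFinset with hF
  have hmemF : ∀ ρ, ρ ∈ F ↔ ρ ∈ zetaZeroBox 0 T' := fun ρ ↦ Set.Finite.mem_toFinset _
  set A := F.filter fun ρ ↦ 1 / 2 + v ≤ ρ.re with hA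
  set B := F.filter fun ρ ↦ ρ.re ≤ 1 / 2 - v with hB
  have hsub : (F.filter fun ρ ↦ v ≤ SelbergSigma.dev ρ) ⊆ A ∪ B := by
    intro ρ hρ
    rw [Finset.mem_filter] at hρ
    rw [Finset.mem_union, hA, hB, Finset.mem_filter, Finset.mem_filter]
    have h := hρ.2
    rw [SelbergSigma.dev, le_abs'] at h
    rcases h with h | h
    · right; exact ⟨hρ.1, by linarith⟩
    · left; exact ⟨hρ.1, by linarith⟩
  have hAc : (A.card : ℝ) ≤ (zetaZeroCountRe (1 / 2 + v) T' : ℝ) := by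
    refine card_le_zetaZeroCountRe fun ρ hρ ↦ ?_
    rw [hA, Finset.mem_filter, hmemF] at hρ
    obtain ⟨⟨h1, -, h3, h4, h5⟩, h6⟩ := hρ
    exact ⟨h1, h6, h3, h4, h5⟩
  -- reflect `B`
  have hBc : (B.card : ℝ) ≤ (zetaZeroCountRe (1 / 2 + v) T' : ℝ) := by
    have hinj : Set.InjOn (fun ρ : ℂ ↦ 1 - conj ρ) (B : Set ℂ) := by
      intro ρ _ ρ' _ h
      simp only at h
      have : conj ρ = conj ρ' := by
        have h' : (1 : ℂ) - (1 - conj ρ) = 1 - (1 - conj ρ') := by rw [h]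
        simpa using h'
      simpa using congrArg conj this
    rw [← Finset.card_image_of_injOn hinj]
    refine card_le_zetaZeroCountRe fun ρ' hρ' ↦ ?_
    rw [Finset.mem_image] at hρ'
    obtain ⟨ρ, hρ, rfl⟩ := hρ'
    rw [hB, Finset.mem_filter, hmemF] at hρ
    obtain ⟨hbox, hle⟩ := hρ
    obtain ⟨h1, -, h3, h4, h5⟩ := one_sub_conj_mem_zetaZeroBox hbox
    refine ⟨h1, ?_, h3, h4, h5⟩
    have : (1 - conj ρ).re = 1 - ρ.re := by simp
    rw [this]; linarith
  have hcard := Finset.card_le_card hsub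
  have hunion := Finset.card_union_le A B
  have : (((F.filter fun ρ ↦ v ≤ SelbergSigma.dev ρ)).card : ℝ) ≤ (A.card : ℝ) + (B.card : ℝ) := by
    exact_mod_cast hcard.trans hunion
  linarith

/-! ## The key sum over the zeros against the density theorem -/

/-- A finite geometric sum: `Σ_{k<n} r^k ≤ 1/(1−r)` for `0 ≤ r < 1`. [folklore] -/
theorem geom_sum_le_inv {r : ℝ} (h0 : 0 ≤ r) (h1 : r < 1) (n : ℕ) :
    ∑ k ∈ Finset.range n, r ^ k ≤ 1 / (1 - r) := by
  have hne : r ≠ 1 := h1.ne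
  rw [geom_sum_eq hne n]
  have e : (r ^ n - 1) / (r - 1) = (1 - r ^ n) / (1 - r) := by
    rw [← neg_sub (r ^ n) 1, ← neg_sub r 1, neg_div_neg_eq]
  rw [e]
  have : 0 ≤ r ^ n := pow_nonneg h0 n
  exact div_le_div_of_nonneg_right (by linarith) (by linarith)

/-- **The key sum** (Selberg 1946, §5): under the zero-density hypothesis `hD` with exponent `c`,
for `0 < θ`, `3θ < c`, `b = (c − 3θ)/2`, `L = log T ≥ 1` and `2T ≥ T₀`,
`Σ_{0<γ≤2T} |β−½|^m e^{3θL|β−½|} ≤ (8C m! e^{b+3θ}/(b^m(1−e^{−b}))) · T L/L^m`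
(each zero counted once; classes `|β−½| ∈ [k/L,(k+1)/L)`, `#{|β−½| ≥ k/L} ≤ 2N(½+k/L, 2T) ≤ 8CTLe^{−ck}`,
`(k+1)^m ≤ m! e^{b(k+1)}/b^m`). [cite: Titchmarsh1986, Thm. 9.19 (C)] -/
theorem sum_dev_pow_mul_exp_le {c C T₀ : ℝ} (hc : 0 < c) (hC : 0 ≤ C)
    (hD : ∀ T : ℝ, T₀ ≤ T → ∀ σ : ℝ, 1 / 2 ≤ σ → σ ≤ 1 →
      (zetaZeroCountRe σ T : ℝ) ≤ C * T ^ (1 - c * (σ - 1 / 2)) * Real.log T)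
    {θ : ℝ} (hθ : 0 < θ) (hθc : 3 * θ < c) (m : ℕ) {T : ℝ} (hT₀ : T₀ ≤ 2 * T) (hT : 3 ≤ T) :
    ∑ ρ ∈ (zetaZeroBox_finite 0 (2 * T)).toFinset,
        SelbergSigma.dev ρ ^ m * Real.exp (3 * (θ * Real.log T) * SelbergSigma.dev ρ) ≤
      (8 * C * m.factorial * Real.exp ((c - 3 * θ) / 2 + 3 * θ) /
          (((c - 3 * θ) / 2) ^ m * (1 - Real.exp (-((c - 3 * θ) / 2))))) *
        (T * Real.log T / Real.log T ^ m) := by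
  classical
  set b : ℝ := (c - 3 * θ) / 2 with hb
  have hb0 : 0 < b := by rw [hb]; linarith
  set L : ℝ := Real.log T with hL
  have hL1 : 1 ≤ L := by
    rw [hL, Real.le_log_iff_exp_le (by linarith)]
    have := Real.exp_one_lt_d9; linarith
  have hL0 : 0 < L := by linarith
  have hT0 : 0 < T := by linarith
  set F := (zetaZeroBox_finite 0 (2 * T)).toFinset with hF
  have hmemF : ∀ ρ, ρ ∈ F ↔ ρ ∈ zetaZeroBox 0 (2 * T) := fun ρ ↦ Set.Finite.mem_toFinset _
  have hnt : ∀ ρ ∈ F, ρ ∈ RHWave0.riemannZetaNontrivialZeros := fun ρ hρ ↦ by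
    have h := (hmemF ρ).1 hρ
    exact ZetaZeros.riemannZetaNontrivialZeros.mem_of_im_ne_zero h.1 h.2.2.2.1.ne'
  -- the class index
  set kk : ℂ → ℕ := fun ρ ↦ ⌊SelbergSigma.dev ρ * L⌋₊ with hkk
  set Kmax : ℕ := ⌊L / 2⌋₊ with hKmax
  have hk_le : ∀ ρ ∈ F, SelbergSigma.dev ρ ≤ (kk ρ + 1) / L := by
    intro ρ _
    rw [le_div_iff₀ hL0]
    exact (Nat.lt_floor_add_one (SelbergSigma.dev ρ * L)).le
  have hk_ge : ∀ ρ : ℂ, (kk ρ : ℝ) / L ≤ SelbergSigma.dev ρ := by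
    intro ρ
    rw [div_le_iff₀ hL0]
    exact Nat.floor_le (mul_nonneg (SelbergSigma.dev_nonneg ρ) hL0.le)
  have hk_mem : ∀ ρ ∈ F, kk ρ ∈ Finset.range (Kmax + 1) := by
    intro ρ hρ
    rw [Finset.mem_range, Nat.lt_add_one_iff, hKmax]
    refine Nat.floor_le_floor ?_
    have := SelbergSigma.dev_lt_half (hnt ρ hρ)
    nlinarith
  -- `g` and its monotonicity
  set g : ℝ → ℝ := fun v ↦ v ^ m * Real.exp (3 * (θ * L) * v) with hg
  have hg_mono : ∀ v w : ℝ, 0 ≤ v → v ≤ w → g v ≤ g w := by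
    intro v w hv hvw
    simp only [hg]
    refine mul_le_mul (pow_le_pow_left₀ hv hvw m) (Real.exp_le_exp.2 ?_) (Real.exp_pos _).le
      (pow_nonneg (hv.trans hvw) m)
    have : 0 ≤ 3 * (θ * L) := by positivity
    nlinarith
  -- Step 1: `Σ g(v_ρ) ≤ Σ_ρ g((k_ρ+1)/L) = Σ_k g((k+1)/L) #fiber_k`
  have step1 : ∑ ρ ∈ F, g (SelbergSigma.dev ρ) ≤
      ∑ k ∈ Finset.range (Kmax + 1), g ((k + 1) / L) * ((F.filter fun ρ ↦ kk ρ = k).card : ℝ) := by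
    calc ∑ ρ ∈ F, g (SelbergSigma.dev ρ) ≤ ∑ ρ ∈ F, g ((kk ρ + 1) / L) :=
          Finset.sum_le_sum fun ρ hρ ↦ hg_mono _ _ (SelbergSigma.dev_nonneg ρ) (hk_le ρ hρ)
      _ = ∑ k ∈ Finset.range (Kmax + 1), ∑ ρ ∈ F with kk ρ = k, g ((k + 1 : ℕ) / L) := by
          rw [Finset.sum_fiberwise_of_maps_to' hk_mem (fun k : ℕ ↦ g ((k + 1 : ℕ) / L))]
          refine Finset.sum_congr rfl fun ρ _ ↦ by push_cast; rfl
      _ = ∑ k ∈ Finset.range (Kmax + 1), g ((k + 1) / L) * ((F.filter fun ρ ↦ kk ρ = k).card : ℝ) := by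
          refine Finset.sum_congr rfl fun k _ ↦ ?_
          rw [Finset.sum_const, nsmul_eq_mul, mul_comm]
          push_cast; rfl
  -- Step 2: `#fiber_k ≤ 8 C T L e^{−ck}` for `k ≤ Kmax`
  have hlog2T : Real.log (2 * T) ≤ 2 * L := by
    rw [Real.log_mul (by norm_num) hT0.ne', hL]
    have := Real.log_two_lt_d9; linarith
  have step2 : ∀ k ∈ Finset.range (Kmax + 1),
      ((F.filter fun ρ ↦ kk ρ = k).card : ℝ) ≤ 8 * C * T * L * Real.exp (-(c * k)) := by
    intro k hk
    rw [Finset.mem_range, Nat.lt_add_one_iff, hKmax] at hk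
    have hkL : (k : ℝ) ≤ L / 2 := by
      have := Nat.floor_le (show 0 ≤ L / 2 by positivity)
      exact le_trans (by exact_mod_cast hk) this
    -- fiber ⊆ {k/L ≤ dev}
    have hsub : (F.filter fun ρ ↦ kk ρ = k) ⊆ F.filter fun ρ ↦ (k : ℝ) / L ≤ SelbergSigma.dev ρ := by
      intro ρ hρ
      rw [Finset.mem_filter] at hρ ⊢
      refine ⟨hρ.1, ?_⟩
      have := hk_ge ρ
      rwa [hρ.2] at this
    have h1 : ((F.filter fun ρ ↦ kk ρ = k).card : ℝ) ≤
        ((F.filter fun ρ ↦ (k : ℝ) / L ≤ SelbergSigma.dev ρ).card : ℝ) := by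
      exact_mod_cast Finset.card_le_card hsub
    have h2 := card_filter_dev_ge_le (2 * T) ((k : ℝ) / L)
    rw [← hF] at h2
    -- density
    have hkL' : (k : ℝ) / L ≤ 1 / 2 := by rw [div_le_iff₀ hL0]; linarith
    have hkL0 : 0 ≤ (k : ℝ) / L := by positivity
    have h3 := hD (2 * T) hT₀ (1 / 2 + (k : ℝ) / L) (by linarith) (by linarith)
    have hexp : (2 * T) ^ (1 - c * (1 / 2 + (k : ℝ) / L - 1 / 2)) ≤ 2 * T * Real.exp (-(c * k)) := by
      have e1 : (2 * T) ^ (1 - c * (1 / 2 + (k : ℝ) / L - 1 / 2)) = (2 * T) * (2 * T) ^ (-(c * k / L)) := by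
        rw [show 1 - c * (1 / 2 + (k : ℝ) / L - 1 / 2) = 1 + (-(c * k / L)) by ring,
          Real.rpow_add (by positivity), Real.rpow_one]
      have e2 : (2 * T) ^ (-(c * k / L)) ≤ T ^ (-(c * k / L)) :=
        Real.rpow_le_rpow_of_nonpos hT0 (by linarith) (by
          have : 0 ≤ c * k / L := by positivity
          linarith)
      have e3 : T ^ (-(c * k / L)) = Real.exp (-(c * k)) := by
        rw [Real.rpow_def_of_pos hT0, ← hL]; congr 1; field_simp
      rw [e1]
      calc 2 * T * (2 * T) ^ (-(c * k / L)) ≤ 2 * T * T ^ (-(c * k / L)) := by gcongr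
        _ = 2 * T * Real.exp (-(c * k)) := by rw [e3]
    have hlog0 : 0 ≤ Real.log (2 * T) := Real.log_nonneg (by linarith)
    have h4 : (zetaZeroCountRe (1 / 2 + (k : ℝ) / L) (2 * T) : ℝ) ≤ C * (2 * T * Real.exp (-(c * k))) * (2 * L) :=
      h3.trans (mul_le_mul (mul_le_mul_of_nonneg_left hexp hC) hlog2T hlog0 (by positivity))
    calc ((F.filter fun ρ ↦ kk ρ = k).card : ℝ)
        ≤ 2 * (zetaZeroCountRe (1 / 2 + (k : ℝ) / L) (2 * T) : ℝ) := h1.trans h2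
      _ ≤ 2 * (C * (2 * T * Real.exp (-(c * k))) * (2 * L)) := by gcongr
      _ = 8 * C * T * L * Real.exp (-(c * k)) := by ring
  -- Step 3: `g((k+1)/L) ≤ (m!/(b^m L^m)) e^{(b+3θ)(k+1)}`
  have step3 : ∀ k : ℕ, g ((k + 1) / L) ≤
      (m.factorial / (b ^ m * L ^ m)) * Real.exp ((b + 3 * θ) * (k + 1)) := by
    intro k
    simp only [hg]
    have hx : 0 ≤ b * (k + 1) := by positivity
    have hfac := Real.pow_div_factorial_le_exp (b * (k + 1)) hx m
    have hmf : (0 : ℝ) < m.factorial := by exact_mod_cast Nat.factorial_pos m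
    rw [div_le_iff₀ hmf, mul_pow] at hfac
    -- `(k+1)^m ≤ m! e^{b(k+1)}/b^m`
    have hk1 : ((k : ℝ) + 1) ^ m ≤ m.factorial * Real.exp (b * (k + 1)) / b ^ m := by
      rw [le_div_iff₀ (by positivity)]
      linarith [mul_comm (b ^ m) (((k : ℝ) + 1) ^ m)]
    have e1 : (((k : ℝ) + 1) / L) ^ m = ((k : ℝ) + 1) ^ m / L ^ m := div_pow _ _ _
    rw [e1]
    have e2 : Real.exp (3 * (θ * L) * ((k + 1) / L)) = Real.exp (3 * θ * (k + 1)) := by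
      congr 1; field_simp
    rw [e2]
    calc ((k : ℝ) + 1) ^ m / L ^ m * Real.exp (3 * θ * (k + 1))
        ≤ (m.factorial * Real.exp (b * (k + 1)) / b ^ m) / L ^ m * Real.exp (3 * θ * (k + 1)) := by
          gcongr
      _ = (m.factorial / (b ^ m * L ^ m)) * (Real.exp (b * (k + 1)) * Real.exp (3 * θ * (k + 1))) := by
          field_simp
      _ = (m.factorial / (b ^ m * L ^ m)) * Real.exp ((b + 3 * θ) * (k + 1)) := by
          rw [← Real.exp_add]; congr 1; ring
  -- Step 4: combine: term_k ≤ A₀ e^{−bk}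
  set A₀ : ℝ := (m.factorial / (b ^ m * L ^ m)) * Real.exp (b + 3 * θ) * (8 * C * T * L) with hA₀
  have hA₀0 : 0 ≤ A₀ := by positivity
  have step4 : ∀ k ∈ Finset.range (Kmax + 1),
      g ((k + 1) / L) * ((F.filter fun ρ ↦ kk ρ = k).card : ℝ) ≤ A₀ * Real.exp (-b) ^ k := by
    intro k hk
    have h1 := step3 k
    have h2 := step2 k hk
    have hg0 : 0 ≤ g ((k + 1) / L) := by
      simp only [hg]; exact mul_nonneg (pow_nonneg (by positivity) m) (Real.exp_pos _).le
    calc g ((k + 1) / L) * ((F.filter fun ρ ↦ kk ρ = k).card : ℝ)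
        ≤ ((m.factorial / (b ^ m * L ^ m)) * Real.exp ((b + 3 * θ) * (k + 1))) *
            (8 * C * T * L * Real.exp (-(c * k))) :=
          mul_le_mul h1 h2 (by positivity) (le_trans hg0 h1)
      _ = A₀ * (Real.exp ((b + 3 * θ) * k) * Real.exp (-(c * k))) := by
          rw [hA₀, show (b + 3 * θ) * ((k : ℝ) + 1) = (b + 3 * θ) + (b + 3 * θ) * k by ring, Real.exp_add]
          ring
      _ = A₀ * Real.exp (-b) ^ k := by
          rw [← Real.exp_add, ← Real.exp_nat_mul]
          congr 2
          rw [hb]; ring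
  -- Step 5: the geometric sum
  have hr0 : 0 ≤ Real.exp (-b) := (Real.exp_pos _).le
  have hr1 : Real.exp (-b) < 1 := by
    have := Real.exp_lt_exp.2 (show -b < 0 by linarith); rwa [Real.exp_zero] at this
  have step5 : ∑ k ∈ Finset.range (Kmax + 1), A₀ * Real.exp (-b) ^ k ≤ A₀ * (1 / (1 - Real.exp (-b))) := by
    rw [← Finset.mul_sum]
    exact mul_le_mul_of_nonneg_left (geom_sum_le_inv hr0 hr1 _) hA₀0
  -- conclusion
  have hfinal : A₀ * (1 / (1 - Real.exp (-b))) =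
      (8 * C * m.factorial * Real.exp (b + 3 * θ) / (b ^ m * (1 - Real.exp (-b)))) * (T * L / L ^ m) := by
    rw [hA₀]
    have h1 : (1 - Real.exp (-b)) ≠ 0 := by linarith
    have h2 : (b ^ m * L ^ m) ≠ 0 := by positivity
    have h3 : L ^ m ≠ 0 := by positivity
    field_simp
  calc ∑ ρ ∈ F, SelbergSigma.dev ρ ^ m * Real.exp (3 * (θ * L) * SelbergSigma.dev ρ)
      = ∑ ρ ∈ F, g (SelbergSigma.dev ρ) := rfl
    _ ≤ ∑ k ∈ Finset.range (Kmax + 1), g ((k + 1) / L) * ((F.filter fun ρ ↦ kk ρ = k).card : ℝ) := step1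
    _ ≤ ∑ k ∈ Finset.range (Kmax + 1), A₀ * Real.exp (-b) ^ k := Finset.sum_le_sum step4
    _ ≤ A₀ * (1 / (1 - Real.exp (-b))) := step5
    _ = _ := hfinal

/-! ## The moments of `σ_{x,t} − ½` -/

/-- `∫_a^b nearVal ℓ ρ t ^ m dt ≤ v(ρ)^m · 2·window` (`m ≥ 1`): the integrand is `v(ρ)^m` on the
window `[γ − w, γ + w]` and `0` outside. [folklore] -/
theorem integral_nearVal_pow_le {ℓ : ℝ} (hℓ : 0 < ℓ) (ρ : ℂ) {m : ℕ} (hm : 1 ≤ m) {a b : ℝ} (hab : a ≤ b) :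
    ∫ t in a..b, SelbergSigma.nearVal ℓ ρ t ^ m ≤ SelbergSigma.dev ρ ^ m * (2 * SelbergSigma.window ℓ ρ) := by
  set S := Set.Icc (ρ.im - SelbergSigma.window ℓ ρ) (ρ.im + SelbergSigma.window ℓ ρ) with hS
  have hw := SelbergSigma.window_pos hℓ ρ
  have hind : ∀ t, SelbergSigma.nearVal ℓ ρ t ^ m = S.indicator (fun _ ↦ SelbergSigma.dev ρ ^ m) t := by
    intro t
    rw [SelbergSigma.nearVal, ← hS]
    by_cases ht : t ∈ S
    · rw [Set.indicator_of_mem ht, Set.indicator_of_mem ht]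
    · rw [Set.indicator_of_notMem ht, Set.indicator_of_notMem ht, zero_pow (by omega)]
  have hvol : volume S = ENNReal.ofReal (2 * SelbergSigma.window ℓ ρ) := by
    rw [hS, Real.volume_Icc]; congr 1; ring
  have hint : Integrable (S.indicator fun _ : ℝ ↦ SelbergSigma.dev ρ ^ m) volume := by
    refine (integrable_indicator_iff measurableSet_Icc).2 (integrableOn_const ?_)
    rw [hvol]; exact ENNReal.ofReal_ne_top
  simp_rw [hind]
  rw [intervalIntegral.integral_of_le hab]
  calc ∫ t in Ioc a b, S.indicator (fun _ ↦ SelbergSigma.dev ρ ^ m) t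
      ≤ ∫ t, S.indicator (fun _ ↦ SelbergSigma.dev ρ ^ m) t :=
        setIntegral_le_integral hint (ae_of_all _ fun t ↦ Set.indicator_nonneg
          (fun _ _ ↦ pow_nonneg (SelbergSigma.dev_nonneg ρ) m) t)
    _ = SelbergSigma.dev ρ ^ m * (2 * SelbergSigma.window ℓ ρ) := by
        rw [integral_indicator_const _ measurableSet_Icc, smul_eq_mul, mul_comm, measureReal_def, hvol,
          ENNReal.toReal_ofReal (by positivity)]

/-- **Selberg's moment bound for `σ_{x,t} − ½`** (Selberg 1946, §5; Titchmarsh §14.21–14.22 on RH):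
under the zero-density hypothesis `hD` with exponent `c`, for `0 < θ`, `3θ < c`, `θ ≤ 1/3` and `m ≥ 1`
there are `K, T₁` such that for `T ≥ T₁`, with `ℓ = θ log T` (`x = T^θ`),
`∫_{T/2}^{T} (σ_{x,t} − ½)^m dt ≤ K T/ℓ^m`. [cite: Titchmarsh1986, Thm. 9.19 (C)] -/
theorem integral_delta_pow_le {c C T₀ : ℝ} (hc : 0 < c) (hC : 0 ≤ C)
    (hD : ∀ T : ℝ, T₀ ≤ T → ∀ σ : ℝ, 1 / 2 ≤ σ → σ ≤ 1 →
      (zetaZeroCountRe σ T : ℝ) ≤ C * T ^ (1 - c * (σ - 1 / 2)) * Real.log T)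
    {θ : ℝ} (hθ : 0 < θ) (hθc : 3 * θ < c) (hθ1 : θ ≤ 1 / 3) {m : ℕ} (hm : 1 ≤ m) :
    ∃ K T₁ : ℝ, ∀ T : ℝ, T₁ ≤ T →
      ∫ t in T / 2..T, SelbergSigma.delta (θ * Real.log T) t ^ m ≤ K * T / (θ * Real.log T) ^ m := by
  classical
  set K' : ℝ := 8 * C * m.factorial * Real.exp ((c - 3 * θ) / 2 + 3 * θ) /
    (((c - 3 * θ) / 2) ^ m * (1 - Real.exp (-((c - 3 * θ) / 2)))) with hK'
  have hb0 : 0 < (c - 3 * θ) / 2 := by linarith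
  have hK'0 : 0 ≤ K' := by
    rw [hK']
    refine div_nonneg (by positivity) (mul_nonneg (pow_nonneg hb0.le m) ?_)
    have := Real.exp_lt_exp.2 (show -((c - 3 * θ) / 2) < 0 by linarith)
    rw [Real.exp_zero] at this; linarith
  refine ⟨(2 : ℝ) ^ m * ((2 : ℝ) ^ m / 2 + 2 * K' * θ ^ (m - 1)),
    max (max T₀ 16) (Real.exp (8 / θ)), fun T hT ↦ ?_⟩
  -- sizes
  have hT16 : 16 ≤ T := le_trans (le_trans (le_max_right _ _) (le_max_left _ _)) hT
  have hT0 : 0 < T := by linarith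
  have hT₀ : T₀ ≤ 2 * T := by
    have := le_trans (le_trans (le_max_left _ _) (le_max_left _ _)) hT; linarith
  set L := Real.log T with hL
  have hL8 : 8 / θ ≤ L := by
    rw [hL, Real.le_log_iff_exp_le hT0]; exact le_trans (le_max_right _ _) hT
  have hθL : 8 ≤ θ * L := by
    have := mul_le_mul_of_nonneg_left hL8 hθ.le
    rwa [mul_div_cancel₀ _ hθ.ne'] at this
  set ℓ := θ * L with hℓ
  have hℓ0 : 0 < ℓ := by rw [hℓ]; linarith
  have hℓ4 : 4 < ℓ := by rw [hℓ]; linarith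
  have hL0 : 0 < L := lt_of_lt_of_le (by positivity) hL8
  set F := (zetaZeroBox_finite 0 (2 * T)).toFinset with hF
  have hmemF : ∀ ρ, ρ ∈ F ↔ ρ ∈ zetaZeroBox 0 (2 * T) := fun ρ ↦ Set.Finite.mem_toFinset _
  -- near zeros for `t ∈ [T/2, T]` are in `F`
  have hR : Real.exp (3 * ℓ / 2) / ℓ ≤ T / 4 := by
    have h1 : Real.exp (3 * ℓ / 2) ≤ T ^ (1 / 2 : ℝ) := by
      rw [Real.rpow_def_of_pos hT0, ← hL, Real.exp_le_exp, hℓ]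
      nlinarith
    have h2 : T ^ (1 / 2 : ℝ) ≤ T / 4 := by
      have hs : T ^ (1 / 2 : ℝ) = Real.sqrt T := (Real.sqrt_eq_rpow T).symm
      rw [hs, le_div_iff₀ (by norm_num)]
      have h4 : 4 ≤ Real.sqrt T := by
        rw [show (4 : ℝ) = Real.sqrt 16 by rw [show (16 : ℝ) = 4 ^ 2 by norm_num, Real.sqrt_sq (by norm_num)]]
        exact Real.sqrt_le_sqrt hT16
      nlinarith [Real.sq_sqrt hT0.le, Real.sqrt_nonneg T]
    calc Real.exp (3 * ℓ / 2) / ℓ ≤ Real.exp (3 * ℓ / 2) / 1 :=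
          div_le_div_of_nonneg_left (Real.exp_pos _).le one_pos (by linarith)
      _ ≤ T / 4 := by rw [div_one]; exact h1.trans h2
  have hnearF : ∀ t ∈ Set.Icc (T / 2) T, ∀ ρ ∈ RHWave0.riemannZetaNontrivialZeros,
      SelbergSigma.IsNear ℓ t ρ → ρ ∈ F := by
    intro t ht ρ hρ hn
    have hd := (SelbergSigma.abs_sub_im_le_of_isNear hℓ0 hρ hn).trans hR
    rw [abs_le] at hd
    rw [hmemF]
    refine ⟨ZetaZeros.riemannZetaNontrivialZeros.zeta_eq_zero hρ,
      (ZetaZeros.riemannZetaNontrivialZeros.re_pos hρ).le,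
      (ZetaZeros.riemannZetaNontrivialZeros.re_lt_one hρ).le, ?_, ?_⟩
    · linarith [ht.1, hd.2]
    · linarith [ht.2, hd.1]
  -- pointwise bound on `[T/2, T]`
  have hm0 : m ≠ 0 := by omega
  set G : ℝ → ℝ := fun t ↦ (2 : ℝ) ^ m * ((2 / ℓ) ^ m + ∑ ρ ∈ F, SelbergSigma.nearVal ℓ ρ t ^ m) with hG
  have hpt : ∀ t ∈ Set.Icc (T / 2) T, SelbergSigma.delta ℓ t ^ m ≤ G t := fun t ht ↦
    SelbergSigma.delta_pow_le hℓ0 t m hm0 F (hnearF t ht)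
  -- integrability
  have hab : T / 2 ≤ T := by linarith
  have hδmeas : Measurable fun t ↦ SelbergSigma.delta ℓ t ^ m := (SelbergSigma.measurable_delta ℓ).pow_const m
  have hGmeas : Measurable G := by
    rw [hG]
    refine measurable_const.mul (measurable_const.add ?_)
    refine Finset.measurable_sum _ fun ρ _ ↦ (SelbergSigma.measurable_nearVal ℓ ρ).pow_const m
  have hfin : volume (Set.Ioc (T / 2) T) ≠ ⊤ := by rw [Real.volume_Ioc]; exact ENNReal.ofReal_ne_top
  have hδint : IntervalIntegrable (fun t ↦ SelbergSigma.delta ℓ t ^ m) volume (T / 2) T := by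
    rw [intervalIntegrable_iff_integrableOn_Ioc_of_le hab]
    refine Measure.integrableOn_of_bounded (M := 1) hfin hδmeas.aestronglyMeasurable ?_
    refine (ae_restrict_iff' measurableSet_Ioc).2 (ae_of_all _ fun t _ ↦ ?_)
    have h1 := SelbergSigma.delta_lt_one hℓ4 t
    have h0 := (SelbergSigma.delta_pos hℓ0 t).le
    rw [Real.norm_eq_abs, abs_of_nonneg (pow_nonneg h0 m)]
    exact pow_le_one₀ h0 h1.le
  have hGint : IntervalIntegrable G volume (T / 2) T := by
    rw [intervalIntegrable_iff_integrableOn_Ioc_of_le hab]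
    refine Measure.integrableOn_of_bounded (M := (2 : ℝ) ^ m * ((2 / ℓ) ^ m + (F.card : ℝ))) hfin
      hGmeas.aestronglyMeasurable ?_
    refine (ae_restrict_iff' measurableSet_Ioc).2 (ae_of_all _ fun t _ ↦ ?_)
    have hsum : ∑ ρ ∈ F, SelbergSigma.nearVal ℓ ρ t ^ m ≤ F.card := by
      have : ∀ ρ ∈ F, SelbergSigma.nearVal ℓ ρ t ^ m ≤ 1 := by
        intro ρ hρ
        have hρ' : ρ ∈ RHWave0.riemannZetaNontrivialZeros := by
          have h := (hmemF ρ).1 hρ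
          exact ZetaZeros.riemannZetaNontrivialZeros.mem_of_im_ne_zero h.1 h.2.2.2.1.ne'
        refine pow_le_one₀ (SelbergSigma.nearVal_nonneg ℓ ρ t) ?_
        by_cases hn : SelbergSigma.IsNear ℓ t ρ
        · rw [SelbergSigma.nearVal_of_isNear hn]; linarith [SelbergSigma.dev_lt_half hρ']
        · rw [SelbergSigma.nearVal_of_not_isNear hn]; norm_num
      calc ∑ ρ ∈ F, SelbergSigma.nearVal ℓ ρ t ^ m ≤ ∑ _ρ ∈ F, (1 : ℝ) := Finset.sum_le_sum this
        _ = F.card := by simp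
    have hS0 : 0 ≤ ∑ ρ ∈ F, SelbergSigma.nearVal ℓ ρ t ^ m :=
      Finset.sum_nonneg fun ρ _ ↦ pow_nonneg (SelbergSigma.nearVal_nonneg ℓ ρ t) m
    have hG0 : 0 ≤ G t := by
      simp only [hG]
      exact mul_nonneg (pow_nonneg (by norm_num) m) (add_nonneg (pow_nonneg (by positivity) m) hS0)
    rw [Real.norm_eq_abs, abs_of_nonneg hG0]
    simp only [hG]
    exact mul_le_mul_of_nonneg_left (add_le_add_right hsum _) (pow_nonneg (by norm_num) m)
  -- integrability of the window terms
  have hnear_le_one : ∀ ρ ∈ F, ∀ t : ℝ, SelbergSigma.nearVal ℓ ρ t ^ m ≤ 1 := by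
    intro ρ hρ t
    have hρ' : ρ ∈ RHWave0.riemannZetaNontrivialZeros := by
      have h := (hmemF ρ).1 hρ
      exact ZetaZeros.riemannZetaNontrivialZeros.mem_of_im_ne_zero h.1 h.2.2.2.1.ne'
    refine pow_le_one₀ (SelbergSigma.nearVal_nonneg ℓ ρ t) ?_
    by_cases hn : SelbergSigma.IsNear ℓ t ρ
    · rw [SelbergSigma.nearVal_of_isNear hn]; linarith [SelbergSigma.dev_lt_half hρ']
    · rw [SelbergSigma.nearVal_of_not_isNear hn]; norm_num
  have hρint : ∀ ρ ∈ F, IntervalIntegrable (fun t ↦ SelbergSigma.nearVal ℓ ρ t ^ m) volume (T / 2) T := by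
    intro ρ hρ
    rw [intervalIntegrable_iff_integrableOn_Ioc_of_le hab]
    refine Measure.integrableOn_of_bounded (M := 1) hfin
      ((SelbergSigma.measurable_nearVal ℓ ρ).pow_const m).aestronglyMeasurable ?_
    refine (ae_restrict_iff' measurableSet_Ioc).2 (ae_of_all _ fun t _ ↦ ?_)
    rw [Real.norm_eq_abs, abs_of_nonneg (pow_nonneg (SelbergSigma.nearVal_nonneg ℓ ρ t) m)]
    exact hnear_le_one ρ hρ t
  have hsumint : IntervalIntegrable (fun t ↦ ∑ ρ ∈ F, SelbergSigma.nearVal ℓ ρ t ^ m) volume (T / 2) T := by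
    have h := IntervalIntegrable.sum F hρint
    have e : (∑ ρ ∈ F, fun t ↦ SelbergSigma.nearVal ℓ ρ t ^ m) =
        fun t ↦ ∑ ρ ∈ F, SelbergSigma.nearVal ℓ ρ t ^ m := by
      funext t; exact Finset.sum_apply t F _
    rwa [e] at h
  -- integrate
  have hI1 : ∫ t in T / 2..T, SelbergSigma.delta ℓ t ^ m ≤ ∫ t in T / 2..T, G t :=
    intervalIntegral.integral_mono_on hab hδint hGint hpt
  have hI2a : ∫ t in T / 2..T, G t =
      (2 : ℝ) ^ m * ∫ t in T / 2..T, ((2 / ℓ) ^ m + ∑ ρ ∈ F, SelbergSigma.nearVal ℓ ρ t ^ m) := by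
    simp only [hG]; exact intervalIntegral.integral_const_mul _ _
  have hI2b : ∫ t in T / 2..T, ((2 / ℓ) ^ m + ∑ ρ ∈ F, SelbergSigma.nearVal ℓ ρ t ^ m) =
      (T - T / 2) * (2 / ℓ) ^ m + ∑ ρ ∈ F, ∫ t in T / 2..T, SelbergSigma.nearVal ℓ ρ t ^ m := by
    rw [intervalIntegral.integral_add intervalIntegrable_const hsumint, intervalIntegral.integral_const,
      smul_eq_mul, intervalIntegral.integral_finsetSum hρint]
  have hI3 : ∑ ρ ∈ F, ∫ t in T / 2..T, SelbergSigma.nearVal ℓ ρ t ^ m ≤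
      (2 / ℓ) * ∑ ρ ∈ F, SelbergSigma.dev ρ ^ m * Real.exp (3 * (θ * Real.log T) * SelbergSigma.dev ρ) := by
    rw [Finset.mul_sum]
    refine Finset.sum_le_sum fun ρ _ ↦ ?_
    refine (integral_nearVal_pow_le hℓ0 ρ hm hab).trans_eq ?_
    rw [SelbergSigma.window, hℓ, hL]; ring
  have hkey := sum_dev_pow_mul_exp_le hc hC hD hθ hθc m hT₀ (by linarith)
  rw [← hK', ← hL] at hkey
  -- assemble
  have h2ℓ : 0 ≤ 2 / ℓ := by positivity
  have hsum0 : 0 ≤ ∑ ρ ∈ F, SelbergSigma.dev ρ ^ m * Real.exp (3 * (θ * Real.log T) * SelbergSigma.dev ρ) :=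
    Finset.sum_nonneg fun ρ _ ↦ mul_nonneg (pow_nonneg (SelbergSigma.dev_nonneg ρ) m) (Real.exp_pos _).le
  have hLℓ : L = ℓ / θ := by rw [hℓ]; field_simp
  have hfinal : (2 : ℝ) ^ m * ((T - T / 2) * (2 / ℓ) ^ m + (2 / ℓ) * (K' * (T * L / L ^ m))) =
      (2 : ℝ) ^ m * ((2 : ℝ) ^ m / 2 + 2 * K' * θ ^ (m - 1)) * T / (θ * Real.log T) ^ m := by
    rw [← hL, ← hℓ, hLℓ]
    have hθ0 : θ ≠ 0 := hθ.ne'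
    have hℓne : ℓ ≠ 0 := hℓ0.ne'
    obtain ⟨m', rfl⟩ : ∃ m', m = m' + 1 := ⟨m - 1, by omega⟩
    simp only [Nat.add_sub_cancel]
    have e1 : (T - T / 2) * (2 / ℓ) ^ (m' + 1) = (2 : ℝ) ^ (m' + 1) / 2 * (T / ℓ ^ (m' + 1)) := by
      rw [div_pow]; ring
    have e2 : 2 / ℓ * (K' * (T * (ℓ / θ) / (ℓ / θ) ^ (m' + 1))) = 2 * K' * θ ^ m' * (T / ℓ ^ (m' + 1)) := by
      rw [div_pow, pow_succ, pow_succ]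
      field_simp
    rw [e1, e2]
    field_simp
  calc ∫ t in T / 2..T, SelbergSigma.delta ℓ t ^ m ≤ ∫ t in T / 2..T, G t := hI1
    _ = (2 : ℝ) ^ m * ((T - T / 2) * (2 / ℓ) ^ m + ∑ ρ ∈ F, ∫ t in T / 2..T, SelbergSigma.nearVal ℓ ρ t ^ m) := by
        rw [hI2a, hI2b]
    _ ≤ (2 : ℝ) ^ m * ((T - T / 2) * (2 / ℓ) ^ m + (2 / ℓ) * (K' * (T * L / L ^ m))) := by
        gcongr
        exact hI3.trans (mul_le_mul_of_nonneg_left (by rw [hL]; exact hkey) h2ℓ)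
    _ = _ := hfinal

end SelbergMoments

end Literature.NumberTheory.LFunctions
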